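import Literature.MathematicalPhysics.QuantumFieldTheory.Balaban1983to89.B9Thm314QGQFlatV1
import Literature.MathematicalPhysics.QuantumFieldTheory.Balaban1983to89.B6QGQCoerciveKLevelV1

/-!
# `Balaban1983to89.B9Thm314QGQInvFlatV1MultiLevelTorus` — [B9] THEOREM 3.14 (pp. 426–427, (3.154)) AT `U = 1` FOR THE GENUINE
`k`-LEVEL `(QGQ*)⁻¹ = B6SectAVectorModelV1.EE (domT hN D hk)` ON THE V1 TORUS, FILE Q3 OF 3: THE UNCONDITIONAL THEOREM — for two
nested families `{Ω_j}`, `{Ω′_j}` on one torus and every pair of common top index bonds `i, i′`,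
`|(QG[Ω]Q*)⁻¹(i, i′) − (QG[Ω′]Q*)⁻¹(i, i′)| ≤ C·Λ_i⁻¹Λ′_{i′}⁻¹·e^{−δ min(ρ, ρ′)}·e^{−δ d(βi, β′i′, Ω)}` (instantiation of the engine
`B9Thm314QGQInvFlatV1Transfer.thm314_QGQinv_of_hyps` with r03's k-level (2.149)/(2.142), this seat's Thm 3.14 for `G`, file Q1 and
Lemma 2.1 on the torus; theorems only; no existing module is touched; no fact is minted)

FRAMING (verbatim cell line):
statement-level skeleton of published theorems with citation tags; proofs where landed; nothing here is a claim about the Yang–Mills mass gap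

Sources under audit (cell lit-balaban): T. Bałaban, *Propagators for lattice gauge theories in a background field*, Commun.
Math. Phys. **99** (1985) 389–434 [`Balaban1985BackgroundPropagators`, "B9"], pp. 426–427 [PDF 38–39] (Theorem 3.14, (3.154)) —
held text `paper:balaban1985-cmp99-background-propagators` p0038/p0039 re-read this generation; T. Bałaban, *Propagators and
renormalization transformations for lattice gauge theories. II*, Commun. Math. Phys. **96** (1984) 223–250
[`Balaban1984PropagatorsII`, "[4]"], Prop. 2.7 (2.149) p. 249, (2.142)/(2.147) p. 248, Lemma 2.1 (2.59)–(2.61) p. 234.  Unit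
`lit-balaban-p21` (Phase-2 proof seat p21 gen 24, HOME `run/shared/lean/pub/lit-balaban/`, free-target protocol G.5-34(d), TAKING
2026-08-25T03:23Z; B9 fold owner r06, B6 fold owner r03 (author of `B6QGQCoerciveKLevelV1` p381949 / `B6Ineq2142KLevelV1` /
`B6Prop27KLevelV1`, consumed BY NAME), referee ref-4).  Companion files: Q1 `B9Thm314QGQFlatV1`, Q2 `B9Thm314QGQInvFlatV1Transfer`.

## WHAT IS PRINTED (quotations AS PRINTED; «…» marks our elisions)

B9 p. 426–427: «Let us assume that we have two sequences of domains {Ω_j}, {Ω′_j}, both satisfying the conditions (2.1)–(2.4) in [4],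
with M and R sufficiently large, so that all the conditions needed in this paper are satisfied. We construct operators for both
sequences and we define Ω = Ω_k ∩ Ω′_k. Let us take localizations determined by points y, y′ ∈ Ω^{(k)} («…» the points y, y′ in the
case of (Q′G′²Q′*)⁻¹, (QGQ*)⁻¹, etc.). We have **Theorem 3.14.** If we take a pair of operators constructed for the two sequences
{Ω_j}, {Ω′_j}, then their difference satisfies all the inequalities characteristic for operators of the considered type, with the
additional factor exp(−δ₀d(y, y′, Ω)), d(y, y′, Ω) = inf_{y₁∈Ωᶜ∩T^{(k)}} (|y − y₁| + |y₁ − y′|) (3.154) on the right-hand sides.»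
[4] p. 249: «**Proposition 2.7.** The operator (QGQ*)⁻¹ is given by the convergent expansions of the form (2.86), and it
satisfies the bound |(QGQ*)⁻¹(b, b′)| ≤ O(1)(L^jη)^{−2}(L^{j′}η)^{−d}e^{−½δ₄d(b,b′)}, b ∈ Λ_j, b′ ∈ Λ_{j′}. (2.149)».

## WHAT THIS FILE CERTIFIES (kernel-checked; V1 torus `B6GlobalChartV1.PV`, families `domT hN D hk` of p21's `TDomains`; lattice units)

* §1 reshaping of the one-family inputs: `flat_of_2142` ((2.142) `|X(a,b)| ≤ A′(L^{j(a)}/c_f)²(L^{j(b)D})⁻¹e^{−δρ}` ⇒ the symmetric flat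
  form `≤ A′Λ_aΛ_be^{−δρ}` by r03's `Tc_entry_le`), `entEE_of_prop27` (the (2.149) entries in the engine's shape), `sum_exp_rho_le` (the
  Lemma-2.1 profile of the index bonds at rate `¼δ` from `Ineq261With c (geomT D) δ ¼`: `Σ_u e^{−¼δρ(a,u)} ≤ 2D·c`, by `card_fiber_beta_le`);
* §2 **`thm314_QGQinv_flat_V1`** — THE THEOREM: `∃ δ C M₀ > 0, N₀` (functions of `d, L, b₀, b₁`) such that for every V1 torus, every two
  families `D, D′ : TDomains` (`k ≥ 2`, `M_h = L^a ≥ 8`, `R ≥ 2L²`, `P′ ≥ 5L`, `L ≥ 5` odd, placed cubes for both, `M₀ ≤ L·M_h`,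
  `N₀ + 1 ≤ R·L·M_h`), `c_f ≠ 0`, band weights `w, w′` agreeing on the common index pairs, and EVERY common top `i ∈ 𝔅[D]`, `i′ ∈ 𝔅[D′]`:
  `|⟪e_i, EE[D] e_{i′_D}⟫ − ⟪e_ĩ, EE[D′] e_{i′}⟫| ≤ C·Λ_i⁻¹Λ′_{i′}⁻¹·e^{−δ·min(ρ(i,i′_D), ρ′(ĩ,i′))}·e^{−δ·d(βi, β′i′, Ω)}`
  (`Λ_i⁻¹Λ′_{i′}⁻¹ = c_f²(L^k)^{D−2}`; witnesses: `δ = ¼·min(δ₄, δ₃, δ_G)` of the three inputs at `σ = σ₁`, `α = ½`; `M₀`, `N₀` the maxima of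
  the input thresholds and of `consts_260_261` at that rate).  Proof = §1 + `B9Thm314QGQFlatV1.thm314_QGQ_flat_of_hyps` (with
  `B9Thm314GFlatV1Transfer.thm314_G_flat_V1` as `hdiff`) + `B9Thm314QGQInvFlatV1Transfer.thm314_QGQinv_of_hyps`.

## HONEST SCOPE

* `U = 1` only (no background field; B9 states Theorem 3.14 for regular `U`, by reference to the random-walk expansions — here the
  algebraic transfer-resolvent route of files Q1/Q2, declared there); V1 torus lineage of ROUTE V/W (`Ω₁ = T_η`, levels `1 … k`, lattice
  units, placed cubes, `M_h = L^a`) — exactly the setting hypotheses of r03's `prop27_kLevel_unconditional` / `ineq2142_kLevel` (Placed,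
  `P′ ≥ 5`) united with those of `thm314_G_flat_V1` (`P′ ≥ 5L`); only COMMON TOP index bonds (print's «points y, y′ ∈ Ω^{(k)}»); (3.154)
  on the `k`-labels of the carrier blocks (`B9Thm314GpFlatTorusGeometry.dOmega`, `inf ∅ := 0`); the decay factor carries the minimum
  of the two families' (2.46) distances between the carrier blocks (both dominate the plain `|y − y′|` on `T^{(k)}`).  Constants
  existential and ours.  Not claimed: general `U`; the other characteristic inequalities «etc.»; `H = GQ*(QGQ*)⁻¹` (Cor. 2.8) two-family.
  Nothing is inferred from the manuscript: every step is kernel-checked; the quoted sentences locate the statements.  NOT summit progress.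
-/

noncomputable section

open scoped BigOperators InnerProductSpace
open Finset

namespace Literature.MathematicalPhysics.QuantumFieldTheory.Balaban1983to89.B9Thm314QGQInvFlatV1MultiLevelTorus

open B4Reflection242 (boxDom blk)
open B6MultiLevelBoxOperator (N0)
open B6MultiLevelTorusOperator (TDomains)
open B6Geom246MultiLevelBox (bset blkOf)
open B6Geom246MultiLevelTorus (geomT)
open B6SectAOperatorsV1 (QE QsE BondIdx BondIdxSpace)
open B6SectAVectorModelV1 (GE EE)
open B6GlobalChartV1 (PV toBox domT blkV1)
open B6Ineq2142KLevelV1 (lvl β X ineq2142_kLevel)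
open B6Prop27KLevelV1 (wt wt_pos lam lam_pos lam_sq rho rho_isPseudoDist Tc inner_single_Tc Tc_entry_le card_fiber_beta_le)
open B6QGQCoerciveKLevelV1 (gam0 gam0_pos prop27_kLevel_unconditional)
open B6RandomWalk (BlockSupp delta3 delta3_pos)
open B6Ineq2133TwoScaleV1 (onFun)
open B6Prop26KLevelSkeletonV1 (pref)
open B6Lemma21Repaired (Ineq261With)
open B6Cover236MultiLevelBlocks (cubes)
open B6CubeWindowV1 (Placed GlobalBand)
open B9Thm314GpFlatTorusGeometry (dOmega dOmega_nonneg)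
open B9Thm314GpFlatMultiLevelTorus (consts_260_261)
open B9Thm314GFlatV1Kernel (IsCT)
open B9Thm314GFlatV1Transfer (thm314_G_flat_V1)
open B9Thm314QGQInvFlatV1Transfer (ent inner_EE_eq_ent thm314_QGQinv_of_hyps)
open B9Thm314QGQFlatV1 (thm314_QGQ_flat_of_hyps)

variable {d ℓ m K : ℕ} {hd : 1 ≤ d + 1} {hL : Odd (ℓ + 1) ∧ 1 < ℓ + 1}
variable {Mh k R : ℕ} {P' : Fin (d + 1) → ℕ}

/-! ## §1  Reshaping the one-family inputs: flat (2.142), the (2.149) entries, the Lemma-2.1 profile of the index bonds -/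

section Inputs

omit hd hL in
/-- lowering a rate on a non-negative distance. [cite: Balaban1985BackgroundPropagators, Thm 3.14 p.427 («after adjusting a definition of δ₀»), bookkeeping] -/
theorem exp_weaken {δ δ' x : ℝ} (h : δ ≤ δ') (hx : 0 ≤ x) : Real.exp (-(δ' * x)) ≤ Real.exp (-(δ * x)) :=
  Real.exp_le_exp.2 (by nlinarith)

variable (hN : ∀ μ, N0 ℓ Mh k P' μ = (PV d ℓ m K hd hL).sitesPerDir 0) (D₀ : TDomains d ℓ Mh k P' R) (hk : k ≤ m + K)
variable {cf : ℝ} (hcf : cf ≠ 0) {w : BondIdx (domT hN D₀ hk) → ℝ} (hw : ∀ i, 0 < w i)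

/-- **(2.142) IN THE FLAT SYMMETRIC FORM**: `|X(a,b)| ≤ A′(L^{j(a)}/c_f)²(L^{j(b)D})⁻¹e^{−δρ(a,b)}` for all `a, b` (r03's `ineq2142_kLevel`)
gives `|X(a,b)| ≤ A′Λ_aΛ_be^{−δρ(a,b)}` (geometric mean of the two orders, `X` symmetric — r03's `Tc_entry_le`).
[cite: Balaban1984PropagatorsII, (2.142) p.248, (2.81) p.237; Balaban1983RegularityDecay, (5.6) p.594] -/
theorem flat_of_2142 (hMh : 1 ≤ Mh) (hP : ∀ μ, 1 ≤ P' μ) {A' δ : ℝ} (hA : 0 ≤ A')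
    (h2142 : ∀ i i' : BondIdx (domT hN D₀ hk), |X hN D₀ hk hcf hw i i'| ≤
      A' * ((((ℓ + 1 : ℕ) : ℝ)) ^ (lvl hN D₀ hk i) / cf) ^ 2 * ((((ℓ + 1 : ℕ) : ℝ) ^ (d + 1)) ^ (lvl hN D₀ hk i'))⁻¹ *
        Real.exp (-(δ * rho hN D₀ hk i i')))
    (a b : BondIdx (domT hN D₀ hk)) :
    |X hN D₀ hk hcf hw a b| ≤ A' * (lam hN D₀ hk cf a * lam hN D₀ hk cf b) * Real.exp (-(δ * rho hN D₀ hk a b)) := by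
  have hρ := rho_isPseudoDist hN D₀ hk hMh hP
  have h := Tc_entry_le hN D₀ hk hcf hw hA (ρ := rho hN D₀ hk) (fun i i' => hρ.symm i i') h2142 a b
  rw [inner_single_Tc, abs_mul, abs_mul] at h
  have hla := lam_pos hN D₀ hk hcf a
  have hlb := lam_pos hN D₀ hk hcf b
  rw [abs_of_pos (inv_pos.2 hla), abs_of_pos (inv_pos.2 hlb)] at h
  have h2 := mul_le_mul_of_nonneg_left h (mul_pos hla hlb).le
  calc |X hN D₀ hk hcf hw a b|
      = lam hN D₀ hk cf a * lam hN D₀ hk cf b * ((lam hN D₀ hk cf a)⁻¹ * (lam hN D₀ hk cf b)⁻¹ * |X hN D₀ hk hcf hw a b|) := by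
        field_simp
    _ ≤ lam hN D₀ hk cf a * lam hN D₀ hk cf b * (A' * Real.exp (-(δ * rho hN D₀ hk a b))) := h2
    _ = _ := by ring

/-- **THE (2.149) ENTRIES IN THE ENGINE'S SHAPE**: `|⟪e_a, (QGQ*)⁻¹e_b⟫| ≤ Λ_a⁻¹Λ_b⁻¹(S·e^{−δ′ρ})` with `δ ≤ δ′` gives
`|(QGQ*)⁻¹(a,b)| ≤ S·Λ_a⁻¹Λ_b⁻¹·e^{−δρ(a,b)}`. [cite: Balaban1984PropagatorsII, Prop. 2.7 (2.149) p.249, bookkeeping] -/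
theorem entEE_of_prop27 (hMh : 1 ≤ Mh) (hP : ∀ μ, 1 ≤ P' μ) {S δ δ' : ℝ} (hS : 0 ≤ S) (hδ : δ ≤ δ')
    (h : ∀ a b : BondIdx (domT hN D₀ hk),
      |⟪EuclideanSpace.single a (1 : ℝ), EE (domT hN D₀ hk) hcf hw (EuclideanSpace.single b (1 : ℝ))⟫_ℝ| ≤
        (lam hN D₀ hk cf a)⁻¹ * (lam hN D₀ hk cf b)⁻¹ * (S * Real.exp (-(δ' * rho hN D₀ hk a b))))
    (a b : BondIdx (domT hN D₀ hk)) :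
    |ent hN D₀ hk (EE (domT hN D₀ hk) hcf hw) a b|
      ≤ S * ((lam hN D₀ hk cf a)⁻¹ * (lam hN D₀ hk cf b)⁻¹) * Real.exp (-(δ * rho hN D₀ hk a b)) := by
  rw [← inner_EE_eq_ent]
  refine (h a b).trans ?_
  have hρ0 := (rho_isPseudoDist hN D₀ hk hMh hP).nonneg a b
  have hla := lam_pos hN D₀ hk hcf a
  have hlb := lam_pos hN D₀ hk hcf b
  have he := exp_weaken hδ hρ0
  calc (lam hN D₀ hk cf a)⁻¹ * (lam hN D₀ hk cf b)⁻¹ * (S * Real.exp (-(δ' * rho hN D₀ hk a b)))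
      ≤ (lam hN D₀ hk cf a)⁻¹ * (lam hN D₀ hk cf b)⁻¹ * (S * Real.exp (-(δ * rho hN D₀ hk a b))) :=
        mul_le_mul_of_nonneg_left (mul_le_mul_of_nonneg_left he hS) (by positivity)
    _ = _ := by ring

/-- **THE LEMMA-2.1 PROFILE OF THE INDEX BONDS AT RATE `¼δ`**: `Σ_u e^{−¼δρ(a,u)} ≤ 2D·c` from `Σ_{y′} e^{−¼δd_T(y,y′)} ≤ c` on the blocks
(at most `2D` index bonds per carrier block, r03's `card_fiber_beta_le`). [cite: Balaban1984PropagatorsII, Lemma 2.1 (2.61) p.234; Balaban1983RegularityDecay, (5.9) p.595] -/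
theorem sum_exp_rho_le (hk1 : 1 ≤ k) {c δ : ℝ} (h261 : Ineq261With c (geomT D₀) δ (1 / 4)) (a : BondIdx (domT hN D₀ hk)) :
    ∑ u, Real.exp (-(δ / 4 * rho hN D₀ hk a u)) ≤ 2 * ((d : ℝ) + 1) * c := by
  classical
  set g : ↥(bset D₀.toDomains) → ℝ := fun y' => Real.exp (-(δ / 4 * (geomT D₀).dist (β hN D₀ hk a) y')) with hg
  have hg0 : ∀ y', 0 ≤ g y' := fun y' => (Real.exp_pos _).le
  have hc : ∑ y', g y' ≤ c := by
    have h := h261 (β hN D₀ hk a)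
    refine le_trans (le_of_eq (Finset.sum_congr rfl fun y' _ => ?_)) h
    simp only [hg]
    rw [show δ / 4 * (geomT D₀).dist (β hN D₀ hk a) y' = 1 / 4 * δ * (geomT D₀).dist (β hN D₀ hk a) y' by ring]
  have h1 : ∑ u, Real.exp (-(δ / 4 * rho hN D₀ hk a u)) = ∑ u : BondIdx (domT hN D₀ hk), g (β hN D₀ hk u) := rfl
  rw [h1, Finset.sum_comp]
  calc ∑ y' ∈ Finset.univ.image (β hN D₀ hk), (Finset.univ.filter fun u => β hN D₀ hk u = y').card • g y'
      ≤ ∑ y' ∈ Finset.univ.image (β hN D₀ hk), (2 * ((d : ℝ) + 1)) * g y' := Finset.sum_le_sum fun y' _ => by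
        rw [nsmul_eq_mul]
        refine mul_le_mul_of_nonneg_right ?_ (hg0 y')
        exact_mod_cast card_fiber_beta_le hN D₀ hk hk1 y'
    _ ≤ ∑ y', (2 * ((d : ℝ) + 1)) * g y' :=
        Finset.sum_le_sum_of_subset_of_nonneg (Finset.subset_univ _) fun y' _ _ => by positivity
    _ = 2 * ((d : ℝ) + 1) * ∑ y', g y' := by rw [Finset.mul_sum]
    _ ≤ 2 * ((d : ℝ) + 1) * c := mul_le_mul_of_nonneg_left hc (by positivity)

end Inputs

/-! ## §2  THEOREM 3.14 (3.154) AT `U = 1` FOR THE GENUINE `k`-LEVEL `(QGQ*)⁻¹` ON THE V1 TORUS (assembly) -/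

section Main

/-- **[B9] THEOREM 3.14 (3.154) AT `U = 1` FOR `(QGQ*)⁻¹ = EE (domT hN D hk)` ON THE GENUINE `k`-LEVEL V1 TORUS.**  There are `δ, C, M₀ > 0`
and `N₀` (depending on `d, L, b₀, b₁` only) such that for every V1 torus (`hN`), every TWO nested families `D, D′ : TDomains` on it with
`k ≥ 2` levels, `M_h = L^a ≥ 8`, `R ≥ 2L²`, `P′ ≥ 5L`, `L ≥ 5` odd, placed cubes for both families, `M₀ ≤ L·M_h`, `N₀ + 1 ≤ R·L·M_h`, every
`c_f ≠ 0`, weights `w, w′` in the band (2.16) agreeing on the common index pairs, and EVERY PAIR OF COMMON TOP index bonds `i ∈ 𝔅[D]`,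
`i′ ∈ 𝔅[D′]` (read in the other lattice through their twins `i′_D = ⟨i′.1, _⟩`, `ĩ = ⟨i.1, _⟩`):
`|⟪e_i, (QG[Ω]Q*)⁻¹e_{i′_D}⟫ − ⟪e_ĩ, (QG[Ω′]Q*)⁻¹e_{i′}⟫| ≤ C·Λ_i⁻¹Λ′_{i′}⁻¹·e^{−δ·min(ρ(i,i′_D), ρ′(ĩ,i′))}·e^{−δ·d(βi, β′i′, Ω)}`,
`Λ_i⁻¹Λ′_{i′}⁻¹ = c_f²(L^k)^{D−2}` (the flat `ℓ²(𝔅)` weights of r03's `B6Prop27KLevelV1`, lattice units), `ρ = d_T ∘ β` the [4] (2.46) distance of the carrier blocks, `d(·,·,Ω)`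
the (3.154) distance of their `k`-labels — print's «their difference satisfies all the inequalities characteristic for operators of the
considered type [(2.149)], with the additional factor exp(−δ₀d(y, y′, Ω))» for «the points y, y′ in the case of … (QGQ*)⁻¹».  Inputs BY NAME:
r03's `B6QGQCoerciveKLevelV1.prop27_kLevel_unconditional` ((2.149) at k levels, both families), `B6Ineq2142KLevelV1.ineq2142_kLevel` ((2.142)),
this seat's `B9Thm314GFlatV1Transfer.thm314_G_flat_V1` (Thm 3.14 for `G`), file Q1 `thm314_QGQ_flat_of_hyps`, file Q2 `thm314_QGQinv_of_hyps`,
`B9Thm314GpFlatMultiLevelTorus.consts_260_261` (Lemma 2.1 on the torus).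
[cite: Balaban1985BackgroundPropagators, Thm 3.14 (3.154) pp.426–427; Balaban1984PropagatorsII, Prop. 2.7 (2.149) p.249, (2.142) p.248, Lemma 2.1 (2.61) p.234] -/
theorem thm314_QGQinv_flat_V1 (d ℓ : ℕ) (hd : 1 ≤ d + 1) (hL : Odd (ℓ + 1) ∧ 1 < ℓ + 1) {b₀ b₁ : ℝ} (hb₀ : 0 < b₀) (hb₁ : b₀ ≤ b₁) :
    ∃ δ C M₀ : ℝ, ∃ N₀ : ℕ, 0 < δ ∧ 0 < C ∧ 0 < M₀ ∧
      ∀ (m K : ℕ) {Mh k R : ℕ} {P' : Fin (d + 1) → ℕ}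
        (hN : ∀ μ, N0 ℓ Mh k P' μ = (PV d ℓ m K hd hL).sitesPerDir 0) (D D' : TDomains d ℓ Mh k P' R) (hk : k ≤ m + K),
        2 ≤ k → ∀ {a : ℕ}, Mh = (ℓ + 1) ^ a → 8 ≤ Mh → 2 * (ℓ + 1) ^ 2 ≤ R → (∀ μ, 5 * (ℓ + 1) ≤ P' μ) → 4 ≤ ℓ →
        (∀ c : ↥(cubes D.toDomains), Placed ℓ k P' c.1) → (∀ c : ↥(cubes D'.toDomains), Placed ℓ k P' c.1) →
        M₀ ≤ ((ℓ : ℝ) + 1) * Mh → N₀ + 1 ≤ R * ((ℓ + 1) * Mh) →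
        ∀ {cf : ℝ} (hcf : cf ≠ 0) {w : BondIdx (domT hN D hk) → ℝ} (hw : ∀ i, 0 < w i)
          {w' : BondIdx (domT hN D' hk) → ℝ} (hw' : ∀ i', 0 < w' i'),
        GlobalBand b₀ b₁ cf w → GlobalBand b₀ b₁ cf w' →
        (∀ (i : BondIdx (domT hN D hk)) (i' : BondIdx (domT hN D' hk)), i.1 = i'.1 → w i = w' i') →
        ∀ (i : BondIdx (domT hN D hk)) (hi : IsCT hN D D' hk i.1) (i' : BondIdx (domT hN D' hk)) (hi' : IsCT hN D D' hk i'.1),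
          |⟪EuclideanSpace.single i (1 : ℝ),
              EE (domT hN D hk) hcf hw (EuclideanSpace.single (⟨i'.1, hi'.2.1⟩ : BondIdx (domT hN D hk)) (1 : ℝ))⟫_ℝ
            - ⟪EuclideanSpace.single (⟨i.1, hi.2.2⟩ : BondIdx (domT hN D' hk)) (1 : ℝ),
              EE (domT hN D' hk) hcf hw' (EuclideanSpace.single i' (1 : ℝ))⟫_ℝ|
            ≤ C * ((lam hN D hk cf i)⁻¹ * (lam hN D' hk cf i')⁻¹)
              * Real.exp (-(δ * min (rho hN D hk i ⟨i'.1, hi'.2.1⟩) (rho hN D' hk ⟨i.1, hi.2.2⟩ i')))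
              * Real.exp (-(δ * dOmega D D' (β hN D hk i).1.2 (β hN D' hk i').1.2)) := by
  have hb₁0 : 0 ≤ b₁ := le_trans hb₀.le hb₁
  have hL0 : (0 : ℝ) < (((ℓ + 1 : ℕ) : ℝ)) := by positivity
  -- (2.149) at k levels (both families use the same instance)
  obtain ⟨σ₁, hσ₁, hP27⟩ := prop27_kLevel_unconditional d ℓ hd hL hb₀ hb₁
  obtain ⟨A₁, M₁, c₁, N₁, hA₁, hM₁, hc₁, h27⟩ := hP27 σ₁ hσ₁ le_rfl (1 / 2) (by norm_num) (by norm_num)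
  have hγ := gam0_pos d ℓ hb₁0
  have hδ₃ : 0 < delta3 (1 / 2) (2 * σ₁) := delta3_pos (by norm_num) (by linarith)
  obtain ⟨den, hden⟩ : ∃ den : ℝ, den = 2 * (1 * (4 / delta3 (1 / 2) (2 * σ₁)) * (2 * ((d : ℝ) + 1) * c₁)) + 1 := ⟨_, rfl⟩
  have hden0 : 0 < den := by
    have : 0 ≤ 2 * (1 * (4 / delta3 (1 / 2) (2 * σ₁)) * (2 * ((d : ℝ) + 1) * c₁)) := by positivity
    rw [hden]; linarith
  obtain ⟨δE, hδEdef⟩ : ∃ δE : ℝ, δE = min (delta3 (1 / 2) (2 * σ₁) / 4) (gam0 d ℓ b₁ / A₁ / den) := ⟨_, rfl⟩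
  have hδE : 0 < δE := by
    rw [hδEdef]
    exact lt_min (by positivity) (div_pos (div_pos hγ hA₁) hden0)
  obtain ⟨S, hSdef⟩ : ∃ S : ℝ, S = 2 / gam0 d ℓ b₁ := ⟨_, rfl⟩
  have hS : 0 < S := by rw [hSdef]; positivity
  -- (2.142) at k levels
  obtain ⟨σ₂, hσ₂, hP42⟩ := ineq2142_kLevel d ℓ hd hL hb₀ hb₁
  obtain ⟨A₂, M₂, hA₂, hM₂, h42⟩ := hP42 σ₂ hσ₂ le_rfl (1 / 2) (by norm_num) (by norm_num)
  have hδX : 0 < delta3 (1 / 2) (2 * σ₂) := delta3_pos (by norm_num) (by linarith)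
  -- Theorem 3.14 for `G`
  obtain ⟨δG, CG, MG, NG, hδG, hCG, hMG, hNG, hG⟩ := thm314_G_flat_V1 d ℓ hd hL hb₀ hb₁
  -- the common rate and the Lemma-2.1 profile at that rate
  obtain ⟨δu, hδudef⟩ : ∃ δu : ℝ, δu = min δE (min (delta3 (1 / 2) (2 * σ₂)) δG) := ⟨_, rfl⟩
  have hδu : 0 < δu := by rw [hδudef]; exact lt_min hδE (lt_min hδX hδG)
  have hδuE : δu ≤ δE := by rw [hδudef]; exact min_le_left _ _
  have hδuX : δu ≤ delta3 (1 / 2) (2 * σ₂) := by rw [hδudef]; exact (min_le_right _ _).trans (min_le_left _ _)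
  have hδuG : δu ≤ δG := by rw [hδudef]; exact (min_le_right _ _).trans (min_le_right _ _)
  obtain ⟨Nc, c, hNc, hc, h261⟩ := consts_260_261 d ℓ hδu
  obtain ⟨Ks, hKsdef⟩ : ∃ Ks : ℝ, Ks = 2 * ((d : ℝ) + 1) * c := ⟨_, rfl⟩
  have hKs : 0 ≤ Ks := by rw [hKsdef]; positivity
  -- the constants
  obtain ⟨CΔ, hCΔdef⟩ : ∃ CΔ : ℝ, CΔ = 2 * (((ℓ + 1 : ℕ) : ℝ)) ^ (d + 1) * CG * Real.exp (6 * δu) + 2 * A₂ * Real.exp (9 * δu) :=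
    ⟨_, rfl⟩
  have hCΔ : 0 ≤ CΔ := by rw [hCΔdef]; positivity
  obtain ⟨Kt, hKtdef⟩ : ∃ Kt : ℝ, Kt = S ^ 2 * (CΔ + A₂) * Real.exp (δu / 2 * (2 * (ℓ : ℝ) + 11)) * (Ks * Ks) := ⟨_, rfl⟩
  have hKt : 0 ≤ Kt := by rw [hKtdef]; positivity
  refine ⟨δu / 4, Real.sqrt (2 * S) * Real.sqrt Kt + 1, max (max M₁ M₂) MG, max (max N₁ NG) Nc,
    by positivity, by positivity, lt_max_of_lt_right hMG, ?_⟩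
  intro m K Mh k R P' hN D D' hk hk2 a hMha hM8 hR hP5L hℓ hplD hplD' hM hNR cf hcf w hw w' hw' hB hB' hww i hi i' hi'
  -- standing side conditions
  have hk1 : 1 ≤ k := le_trans (by norm_num) hk2
  have hMh : 1 ≤ Mh := le_trans (by norm_num) hM8
  have hP5 : ∀ μ, 5 ≤ P' μ := fun μ => le_trans (Nat.le_mul_of_pos_right 5 (Nat.succ_pos ℓ)) (hP5L μ)
  have hP : ∀ μ, 1 ≤ P' μ := fun μ => le_trans (by norm_num) (hP5 μ)
  have hRM : 2 ≤ R * Mh := by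
    have hR1 : 1 ≤ R := le_trans (Nat.one_le_pow _ _ (by omega)) (le_trans (Nat.le_mul_of_pos_left _ (by norm_num)) hR)
    calc 2 ≤ 1 * 8 := by norm_num
      _ ≤ R * Mh := Nat.mul_le_mul hR1 hM8
  have hM₁' : M₁ ≤ ((ℓ : ℝ) + 1) * Mh := le_trans ((le_max_left _ _).trans (le_max_left _ _)) hM
  have hM₂' : M₂ ≤ ((ℓ : ℝ) + 1) * Mh := le_trans ((le_max_right _ _).trans (le_max_left _ _)) hM
  have hMG' : MG ≤ ((ℓ : ℝ) + 1) * Mh := le_trans (le_max_right _ _) hM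
  have hN₁' : N₁ + 1 ≤ R * ((ℓ + 1) * Mh) :=
    le_trans (Nat.succ_le_succ ((le_max_left _ _).trans (le_max_left _ _))) hNR
  have hNG' : NG + 1 ≤ R * ((ℓ + 1) * Mh) :=
    le_trans (Nat.succ_le_succ ((le_max_right _ _).trans (le_max_left _ _))) hNR
  have hNc' : Nc + 1 ≤ R * ((ℓ + 1) * Mh) := le_trans (Nat.succ_le_succ (le_max_right _ _)) hNR
  -- (2.149) in the engine's shape, both families
  have hE : ∀ a b : BondIdx (domT hN D hk), |ent hN D hk (EE (domT hN D hk) hcf hw) a b|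
      ≤ S * ((lam hN D hk cf a)⁻¹ * (lam hN D hk cf b)⁻¹) * Real.exp (-(δu * rho hN D hk a b)) := by
    refine entEE_of_prop27 hN D hk hcf hw hMh hP hS.le hδuE fun a b => ?_
    have h := h27 m K hN D hk hk2 hMha hM8 hR hP5 hℓ hplD hM₁' hN₁' hcf hw hB a b
    rw [hSdef, hδEdef, hden]
    exact h
  have hE' : ∀ a b : BondIdx (domT hN D' hk), |ent hN D' hk (EE (domT hN D' hk) hcf hw') a b|
      ≤ S * ((lam hN D' hk cf a)⁻¹ * (lam hN D' hk cf b)⁻¹) * Real.exp (-(δu * rho hN D' hk a b)) := by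
    refine entEE_of_prop27 hN D' hk hcf hw' hMh hP hS.le hδuE fun a b => ?_
    have h := h27 m K hN D' hk hk2 hMha hM8 hR hP5 hℓ hplD' hM₁' hN₁' hcf hw' hB' a b
    rw [hSdef, hδEdef, hden]
    exact h
  -- (2.142) flat, both families, rate lowered to `δu`
  have hXf : ∀ a b : BondIdx (domT hN D hk), |X hN D hk hcf hw a b|
      ≤ A₂ * (lam hN D hk cf a * lam hN D hk cf b) * Real.exp (-(δu * rho hN D hk a b)) := by
    intro a b
    have h := flat_of_2142 hN D hk hcf hw hMh hP hA₂
      (fun i₁ i₂ => h42 m K hN D hk hk2 hMha hM8 hR hP5 hℓ hplD hM₂' hcf hw hB i₁ i₂) a b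
    refine h.trans (mul_le_mul_of_nonneg_left (exp_weaken hδuX ((rho_isPseudoDist hN D hk hMh hP).nonneg a b)) ?_)
    exact mul_nonneg hA₂ (mul_pos (lam_pos hN D hk hcf a) (lam_pos hN D hk hcf b)).le
  have hXf' : ∀ a b : BondIdx (domT hN D' hk), |X hN D' hk hcf hw' a b|
      ≤ A₂ * (lam hN D' hk cf a * lam hN D' hk cf b) * Real.exp (-(δu * rho hN D' hk a b)) := by
    intro a b
    have h := flat_of_2142 hN D' hk hcf hw' hMh hP hA₂
      (fun i₁ i₂ => h42 m K hN D' hk hk2 hMha hM8 hR hP5 hℓ hplD' hM₂' hcf hw' hB' i₁ i₂) a b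
    refine h.trans (mul_le_mul_of_nonneg_left (exp_weaken hδuX ((rho_isPseudoDist hN D' hk hMh hP).nonneg a b)) ?_)
    exact mul_nonneg hA₂ (mul_pos (lam_pos hN D' hk hcf a) (lam_pos hN D' hk hcf b)).le
  -- Theorem 3.14 for `G`, rate lowered to `δu`
  have hdT := B6Prop23MultiLevelTorus.isPseudoDist_distT D hMh hP
  have hdT' := B6Prop23MultiLevelTorus.isPseudoDist_distT D' hMh hP
  have hdiff : ∀ (y : ↥(bset D.toDomains)) (hyD' : y.1 ∈ bset D'.toDomains) (y' : ↥(bset D'.toDomains))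
      (hy'D : y'.1 ∈ bset D.toDomains), y.1.1 = k → y'.1.1 = k →
      ∀ (μ : PBond (PV d ℓ m K hd hL) 0 → ℝ) (B : ℝ), BlockSupp (g := geomT D') (blkV1 hN D') μ y' B →
      ∀ x : PBond (PV d ℓ m K hd hL) 0, blkV1 hN D x = y →
        |onFun (GE (domT hN D hk) hcf hw) μ x - onFun (GE (domT hN D' hk) hcf hw') μ x|
          ≤ CG * (pref cf y * B)
            * Real.exp (-(δu * min ((geomT D).dist y ⟨y'.1, hy'D⟩) ((geomT D').dist ⟨y.1, hyD'⟩ y')))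
            * Real.exp (-(δu * dOmega D D' y.1.2 y'.1.2)) := by
    intro y hyD' y' hy'D hy hy' μ B hμ x hx
    have h := hG m K hN D D' hk hk1 hMha hM8 hR hP5L hℓ hMG' hNG' hcf hw hw' hB hB' hww y hyD' y' hy'D hy hy' μ B hμ x hx
    refine h.trans ?_
    have hF : 0 ≤ CG * (pref cf y * B) := mul_nonneg hCG.le (mul_nonneg (B6Prop26KLevelSkeletonV1.pref_nonneg cf y) hμ.nonneg)
    have hmin : 0 ≤ min ((geomT D).dist y ⟨y'.1, hy'D⟩) ((geomT D').dist ⟨y.1, hyD'⟩ y') :=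
      le_min (hdT.nonneg _ _) (hdT'.nonneg _ _)
    exact mul_le_mul (mul_le_mul_of_nonneg_left (exp_weaken hδuG hmin) hF) (exp_weaken hδuG (dOmega_nonneg D D' _ _))
      (Real.exp_pos _).le (mul_nonneg hF (Real.exp_pos _).le)
  -- the two-family (2.142) (file Q1)
  have hΔ : ∀ (u : BondIdx (domT hN D hk)) (hu : IsCT hN D D' hk u.1) (v : BondIdx (domT hN D' hk)) (hv : IsCT hN D D' hk v.1),
      |X hN D' hk hcf hw' ⟨u.1, hu.2.2⟩ v - X hN D hk hcf hw u ⟨v.1, hv.2.1⟩|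
        ≤ CΔ * (lam hN D hk cf u * lam hN D' hk cf v)
          * Real.exp (-(δu * dOmega D D' (β hN D hk u).1.2 (β hN D' hk v).1.2)) := by
    intro u hu v hv
    rw [hCΔdef]
    exact thm314_QGQ_flat_of_hyps hN D D' hk hcf hw hw' hk1 hRM hMh hP hCG.le hA₂ hδu.le hdiff hXf hXf' u hu v hv
  -- the profiles
  have h261D : Ineq261With c (geomT D) δu (1 / 4) := (h261 k Mh R P' hMh hP hNc').2 D
  have h261D' : Ineq261With c (geomT D') δu (1 / 4) := (h261 k Mh R P' hMh hP hNc').2 D'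
  have hSum : ∀ a : BondIdx (domT hN D hk), ∑ u, Real.exp (-(δu / 4 * rho hN D hk a u)) ≤ Ks := fun a => by
    rw [hKsdef]; exact sum_exp_rho_le hN D hk hk1 h261D a
  have hSum' : ∀ b : BondIdx (domT hN D' hk), ∑ v, Real.exp (-(δu / 4 * rho hN D' hk b v)) ≤ Ks := fun b => by
    rw [hKsdef]; exact sum_exp_rho_le hN D' hk hk1 h261D' b
  -- the engine
  have H := thm314_QGQinv_of_hyps hN D D' hk hcf hw hw' hk1 hRM hMh hP hS.le hA₂ hCΔ hδu.le hKs hKs hE hE' hXf hXf' hΔ hSum hSum'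
    hi hi'
  rw [← hKtdef] at H
  refine H.trans ?_
  -- constants and rates
  have hli := lam_pos hN D hk hcf i
  have hli' := lam_pos hN D' hk hcf i'
  have hW : 0 ≤ (lam hN D hk cf i)⁻¹ * (lam hN D' hk cf i')⁻¹ := by positivity
  have hm0 : 0 ≤ min (rho hN D hk i ⟨i'.1, hi'.2.1⟩) (rho hN D' hk ⟨i.1, hi.2.2⟩ i') :=
    le_min ((rho_isPseudoDist hN D hk hMh hP).nonneg _ _) ((rho_isPseudoDist hN D' hk hMh hP).nonneg _ _)
  have he1 : Real.exp (-(1 / 2 * δu * min (rho hN D hk i ⟨i'.1, hi'.2.1⟩) (rho hN D' hk ⟨i.1, hi.2.2⟩ i')))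
      ≤ Real.exp (-(δu / 4 * min (rho hN D hk i ⟨i'.1, hi'.2.1⟩) (rho hN D' hk ⟨i.1, hi.2.2⟩ i'))) :=
    Real.exp_le_exp.2 (by nlinarith)
  have he2 : Real.exp (-(1 / 4 * δu * dOmega D D' (β hN D hk i).1.2 (β hN D' hk i').1.2))
      = Real.exp (-(δu / 4 * dOmega D D' (β hN D hk i).1.2 (β hN D' hk i').1.2)) := by
    congr 1; ring
  rw [he2]
  have hC1 : Real.sqrt (2 * S) * Real.sqrt Kt ≤ Real.sqrt (2 * S) * Real.sqrt Kt + 1 := by linarith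
  have hC0 : 0 ≤ Real.sqrt (2 * S) * Real.sqrt Kt := by positivity
  exact mul_le_mul (mul_le_mul (mul_le_mul_of_nonneg_right hC1 hW) he1 (Real.exp_pos _).le (by positivity)) le_rfl
    (Real.exp_pos _).le (by positivity)

end Main

end Literature.MathematicalPhysics.QuantumFieldTheory.Balaban1983to89.B9Thm314QGQInvFlatV1MultiLevelTorus

end
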